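import Literature.NumberTheory.Automorphic.CDTTheorem722
import Literature.NumberTheory.Automorphic.CDTTheorem722Proofs
import Literature.NumberTheory.Automorphic.CDTTheorem722ThreeFactsProofs
import Literature.NumberTheory.EllipticCurves.InertiaInvariantsAdditiveProofs
import Literature.NumberTheory.Automorphic.CDTTheorem712
import Literature.NumberTheory.Automorphic.CDTTheorem712TwoLiftsProofs
import Literature.NumberTheory.Automorphic.BCDTTheoremB
import Literature.NumberTheory.EllipticCurves.NewformsLevelEqOfHeckeEigenvalueEqProofs
import Literature.NumberTheory.EllipticCurves.NewformsEqOfHeckeEigenvalueEqProofs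
import Literature.NumberTheory.EllipticCurves.NewformsHeckeProofs
import Literature.NumberTheory.EllipticCurves.NewformGaloisRepEulerFactors
import Literature.NumberTheory.EllipticCurves.Szpiro
import Literature.NumberTheory.EllipticCurves.CuspFormTwist
import Literature.NumberTheory.EllipticCurves.HeckeOperatorsProofs
import Summits.ABC.ABC.Theorems.DefiniteXiFreyModularityIsModular
import Literature.NumberTheory.EllipticCurves.TateModuleTwistNewformEulerFactorsProofs
import Literature.NumberTheory.EllipticCurves.CuspFormLFunctionLevelConductorOfCarayolProofs
import Literature.NumberTheory.EllipticCurves.EisensteinNewformLevelRaising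
import Literature.NumberTheory.EllipticCurves.HasseWeilAbelianEulerFactorForallProofs
import Literature.NumberTheory.EllipticCurves.ModularityVersionApProofs
import Literature.NumberTheory.EllipticCurves.RootNumberAtkinLehnerSemistableProofs
import Literature.NumberTheory.GaloisRepresentations.CoinvariantsCharpolyBaseChange
import Literature.NumberTheory.EllipticCurves.TateModuleIrreducibleFrobenius
import Literature.NumberTheory.EllipticCurves.CuspFormLFunctionLevelConductorProofs
import Literature.NumberTheory.GaloisRepresentations.FramedRepBaseChange
import Literature.NumberTheory.GaloisRepresentations.OddAbsolutelyIrreducibleProofs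
import Literature.AlgebraicGeometry.Motives.FaltingsECEndCoreCasesProofs
import Literature.RepresentationTheory.IrreducibleTwistTransport
import Literature.NumberTheory.GaloisRepresentations.FramedRepEquivConj
import Literature.NumberTheory.EllipticCurves.NeronOggShafarevichProofs
import HarnessLib

/-!
# Stub ideation k = 2, generation 5, for `stub_threeImpTwo` (S9) of crux `FreyModularity`
# (stmt-ABC-11340, route-ABC-DefiniteXi) — companion of `STUB-IDEAS-stub_threeImpTwo-2.md` (gen 5).

Gen-5 delta over gen 4 (`…_2g4_Sketch.lean`, 1 sorry): **0 sorries.**  The one gen-4 `sorry` (M3,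
"a rational newform `f₀` carrying `a_p(E)` at every `p ∤ N`, `E` good off `N`, IS the newform of `E`
granted `Carayol1986_eulerFactor`") is discharged by porting, VERBATIM, ideator-1's PROVED gen-3 blocks
(H2′, H3, H4, H5aux, H5, `RatGaloisRepCofinalAt`, B1 `ratGaloisRepCofinalAt_of_curve`,
B2 `isNewformOf_of_cofinalAt_of_carayolEuler`; `section PortK1` below, ≈ 430 lines; their file cannot be
imported — crux-dir companions are not built modules).  Hence the whole compatible-system (T-C) recut is
kernel-checked: `freyModularity_of_recutCS_atoms : (∀ σ, langlands_tunnell σ) → CDT_theorem_7_2_1 →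
CDT_theorem_7_2_2 → CDT_three_five_switch → Carayol1986_eulerFactor → FreyLevelEqConductor → (the
skeleton's four LANDED Frey inputs) → FreyModularity`, axioms standard — NO Eichler–Shimura / `L_A` /
Deligne–Serre / congruence-relation leaf anywhere, and S9 is never applied to the switched curve `W′`.

T-C (gen 4, unchanged): strengthen the HYPOTHESIS of S9 from one prime to every prime
(`IsModularGaloisRepTateAll`; free upstream: the lift stubs are closed from `CDT_theorem_7_2_1/7_2_2`
through the PROVED (2) ⇒ (4) at every prime), fill each packet's `ℓ`-hole with the packet at a second
prime, merge by strong multiplicity one ACROSS LEVELS (tree theorems), read `ρ̄_{W′,5}` modular off `W′`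
Tate-modular AT 5 (M2, no fact), and finish on the Frey curve with Carayol's Euler factors (M3) + level.
-/

-- `Summit.<Summit>.<Problem>`: the duplicate `ABC.ABC` is the mandated namespace (CONVENTIONS §2).
set_option linter.dupNamespace false

noncomputable section

open scoped NumberField Polynomial MatrixGroups ModularForm
open NumberField IsDedekindDomain IsDedekindDomain.HeightOneSpectrum Field Polynomial
open CongruenceSubgroup Rat.HeightOneSpectrum
open Literature.NumberTheory.EllipticCurves
open Literature.NumberTheory.EllipticCurves.ModularForms
open Literature.NumberTheory.Automorphic
open Literature.NumberTheory.Automorphic.BCDT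
open Literature.NumberTheory.GaloisRepresentations
open WeierstrassCurve

namespace Summit.ABC.ABC.Cruxes.FreyModularity.Sketch.StubIdeasThreeImpTwo2G5

/-! ## The stub (verbatim) and the compatible-system cuts -/

/-- The registered stub S9, verbatim. -/
def SigStubThreeImpTwo : Prop :=
  ∀ (W : WeierstrassCurve ℚ) [W.IsElliptic] [NeZero (W.conductorNorm ℤ)] (ℓ : ℕ) [Fact ℓ.Prime],
    W.IsModularGaloisRepTate ℓ → BCDT.IsModular W

/-- BCDT condition (4): `ρ_{E,p}` is modular for EVERY prime `p` (the compatible system). -/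
def IsModularGaloisRepTateAll (W : WeierstrassCurve ℚ) : Prop :=
  ∀ (p : ℕ) [Fact p.Prime], W.IsModularGaloisRepTate p

/-- `h32CS` — S9 with the compatible-system hypothesis (∀W). -/
def SigThreeImpTwoCS : Prop :=
  ∀ (W : WeierstrassCurve ℚ) [W.IsElliptic] [NeZero (W.conductorNorm ℤ)],
    IsModularGaloisRepTateAll W → BCDT.IsModular W

/-- `h32FCS` — the same on Frey curves only (consumers I1, I3). -/
def SigThreeImpTwoFreyCS : Prop :=
  ∀ (a b : ℤ), IsCoprime a b → a * b * (a + b) ≠ 0 →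
    ∀ [(freyCurve a b).IsElliptic] [NeZero ((freyCurve a b).conductorNorm ℤ)],
      IsModularGaloisRepTateAll (freyCurve a b) → BCDT.IsModular (freyCurve a b)

/-- S1b with compatible-system OUTPUT (what `R = T` at `3` + Eichler–Shimura at every `p` prints). -/
def SigLiftThreeCS : Prop :=
  ∀ (W : WeierstrassCurve ℚ) [W.IsElliptic] (ρ : ModPGaloisRep ℚ (ZMod 3) 2),
    W.IsTorsionGaloisRep 3 ρ → ρ.IsAbsIrreducibleOverSqrt (-3) → ¬ 9 ∣ W.conductorNorm ℤ →
    ρ.IsModular → IsModularGaloisRepTateAll W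

/-- S2 with compatible-system OUTPUT. -/
def SigLiftFiveCS : Prop :=
  ∀ (W : WeierstrassCurve ℚ) [W.IsElliptic] (ρ : ModPGaloisRep ℚ (ZMod 5) 2),
    W.IsTorsionGaloisRep 5 ρ → ρ.IsAbsIrreducibleOverSqrt 5 → ¬ 25 ∣ W.conductorNorm ℤ →
    ρ.IsModular → IsModularGaloisRepTateAll W

/-- Carayol's "level = conductor" on the Frey family only (ideator-3's road: the PROVED Frey–Saito
rows + `Carayol1986_artinConductorExponent`, CM corner by the landed `isModular_freyCurve_of_natAbs_eq_two`;
or verbatim from the catalogued ∀W `IsNewformOf.level_eq_conductorNorm`). -/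
def FreyLevelEqConductor : Prop :=
  ∀ (a b : ℤ), IsCoprime a b → a * b * (a + b) ≠ 0 →
    ∀ [(freyCurve a b).IsElliptic] {N : ℕ} [NeZero N] {f : CuspForm (Gamma0 N) 2},
      IsNewformOf (freyCurve a b) f → N = (freyCurve a b).conductorNorm ℤ

/-! ## The strengthened lift stubs cost nothing: closed from the SAME catalogued facts -/

/-- `SigLiftThreeCS ⇐ CDT_theorem_7_2_1` (conclusion `IsModular`, then (2) ⇒ (4) at EVERY prime). -/
theorem sigLiftThreeCS_of_CDT_theorem_7_2_1 (h : CDT_theorem_7_2_1) : SigLiftThreeCS := by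
  intro W _ ρ hρ hirr h9 _ p _
  haveI : NeZero (W.conductorNorm ℤ) := ⟨(conductorNorm_pos_holds W).ne'⟩
  exact (h W ρ hρ hirr fun h27 ↦ h9 (dvd_trans ⟨3, rfl⟩ h27)).isModularGaloisRepTate p

/-- `SigLiftFiveCS ⇐ CDT_theorem_7_2_2`. -/
theorem sigLiftFiveCS_of_CDT_theorem_7_2_2 (h : CDT_theorem_7_2_2) : SigLiftFiveCS := by
  intro W _ ρ hρ hirr _ hmod p _
  haveI : NeZero (W.conductorNorm ℤ) := ⟨(conductorNorm_pos_holds W).ne'⟩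
  exact (h W ρ hρ hirr hmod).isModularGaloisRepTate p

/-- The verbatim `FreyLevelEqConductor ⇐` Carayol ∀W. -/
theorem freyLevelEqConductor_of_carayol
    (hC : ∀ (N : ℕ) [NeZero N], IsNewformOf.level_eq_conductorNorm (N := N)) :
    FreyLevelEqConductor :=
  fun _ _ _ _ _ N _ _ hf ↦ hC N hf

/-- Sanity: the CS cut is WEAKER than S9. -/
theorem sigThreeImpTwoCS_of_stub (h32 : SigStubThreeImpTwo) : SigThreeImpTwoCS := by
  intro W _ _ h
  haveI : Fact (Nat.Prime 3) := ⟨Nat.prime_three⟩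
  exact h32 W 3 (h 3)

/-- Sanity: the Frey CS cut is WEAKER than the ∀W CS cut. -/
theorem sigThreeImpTwoFreyCS_of_CS (h : SigThreeImpTwoCS) : SigThreeImpTwoFreyCS :=
  fun a b _ _ _ _ hall ↦ h (freyCurve a b) hall

/-! ## Helper lemmas (one prover cycle each; M0, M1, M2, the merge and — gen 5 — M3 are all PROVED) -/

/-- The `X`-coefficient of `X² - a X + b` is `-a` (ideator-1's helper, verbatim). [folklore] -/
theorem coeff_one_X_sq_sub_C_mul_X_add_C' {S : Type*} [CommRing S] (a b : S) :
    (Polynomial.X ^ 2 - Polynomial.C a * Polynomial.X + Polynomial.C b).coeff 1 = -a := by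
  simp [Polynomial.coeff_X_pow, Polynomial.coeff_C]

/-- **M0 (descent KEEPING the inertia clause; ideator-1's H1, ported verbatim — PROVED).**
`ρ_{E,ℓ}` modular ⇒ a newform `f₀ ∈ S₂(Γ₀(N))` with `E` good off `N ℓ` (Néron–Ogg–Shafarevich on the
inertia clause of `IsModularGaloisRepTate`) and `a_p(f₀) = a_p(E)` for `p ∤ N ℓ` (the `X`-coefficient
of the Frobenius polynomial); the tree's `exists_rational_isNewform0_of_isModularGaloisRepTate'`
forgets the good reduction, which the merge below needs. -/
theorem exists_isNewform0_hasGoodReductionAt_of_isModularGaloisRepTate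
    (W : WeierstrassCurve ℚ) [W.IsElliptic] (ℓ : ℕ) [Fact ℓ.Prime] (h : W.IsModularGaloisRepTate ℓ) :
    ∃ (N : ℕ) (_ : NeZero N) (f₀ : CuspForm (Gamma0 N) 2), IsNewform0 f₀ ∧
      (∀ v : HeightOneSpectrum (𝓞 ℚ), ¬ ((primesEquiv v : ℕ) ∣ N * ℓ) → W.HasGoodReductionAt v) ∧
      ∀ p : ℕ, p.Prime → ¬ p ∣ N * ℓ → cuspCoeff f₀ p = (W.LFunction p : ℂ) := by
  classical
  have hℓp : ℓ.Prime := Fact.out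
  obtain ⟨N, hN, f, K, hK, hA, ι, hnew, hε, hcl⟩ := (isModularGaloisRepTate_iff_weight_two W ℓ).mp h
  -- descent to `Γ₀(N)`
  have hdia : ∀ d : ZMod N, IsUnit d → diamondOp N 2 d f = f := by
    intro d hd
    obtain ⟨u, rfl⟩ := hd
    rw [hnew.diamondOp_apply_eq_nebentypus_smul u, hε, MulChar.one_apply_coe, one_smul]
  obtain ⟨f₀, hf₀⟩ := exists_liftToGamma1_eq_of_forall_diamondOp_eq 2 f hdia
  have hnew₀ : IsNewform0 f₀ := (isNewform1_liftToGamma1_iff_holds N 2 f₀).mp (hf₀ ▸ hnew)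
  have hcoe : (⇑f₀ : UpperHalfPlane → ℂ) = ⇑f := by rw [← hf₀, coe_liftToGamma1_holds]
  -- good reduction off `N ℓ`: Néron–Ogg–Shafarevich
  have hgood : ∀ v : HeightOneSpectrum (𝓞 ℚ), ¬ ((primesEquiv v : ℕ) ∣ N * ℓ) →
      W.HasGoodReductionAt v := by
    intro v hv
    have hpℓ : (primesEquiv v : ℕ) ≠ ℓ := fun h' ↦ hv (by rw [← h']; exact dvd_mul_left _ _)
    have hℓv : ((ℓ : ℕ) : 𝓞 ℚ) ∉ v.asIdeal := by
      rw [Literature.NumberTheory.GaloisRepresentations.Rat.natCast_mem_asIdeal_iff]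
      exact fun h' ↦ hpℓ ((Nat.prime_dvd_prime_iff_eq (primesEquiv v).2 hℓp).mp h')
    exact W.neronOggShafarevich_holds v ℓ hℓv fun 𝔓 h𝔓 τ hτ ↦ (hcl v hv 𝔓 h𝔓).1 τ hτ
  refine ⟨N, hN, f₀, hnew₀, hgood, fun p hp hpNℓ ↦ ?_⟩
  -- the place `v` of `ℚ` at `p`, a prime of `ℤ̄` above it and an arithmetic Frobenius
  obtain ⟨v, rfl⟩ : ∃ v : HeightOneSpectrum (𝓞 ℚ), (primesEquiv v : ℕ) = p :=
    ⟨primesEquiv.symm ⟨p, hp⟩, by rw [Equiv.apply_symm_apply]⟩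
  obtain ⟨𝔓, h𝔓⟩ := primesAbove_nonempty v
  obtain ⟨σ, hσ⟩ := exists_isArithFrobAt_of_mem_primesAbove_holds (v := v) h𝔓
  have hpℓ : (primesEquiv v : ℕ) ≠ ℓ := fun h' ↦ hpNℓ (by rw [← h']; exact dvd_mul_left _ _)
  have hgoodv : W.HasGoodReductionAt v := hgood v hpNℓ
  have hℓv : ((ℓ : ℕ) : 𝓞 ℚ) ∉ v.asIdeal := by
    rw [Literature.NumberTheory.GaloisRepresentations.Rat.natCast_mem_asIdeal_iff]
    exact fun h' ↦ hpℓ ((Nat.prime_dvd_prime_iff_eq hp hℓp).mp h')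
  have htr := W.trace_galoisRepTate_frobenius_of_hasGoodReductionAt_holds ℓ v hℓv hgoodv h𝔓 hσ
  -- compare the `X`-coefficients of the two characteristic polynomials
  have h1 := congrArg (fun P : Polynomial K ↦ P.coeff 1) ((hcl v hpNℓ 𝔓 h𝔓).2 σ hσ)
  rw [Polynomial.coeff_map, Polynomial.coeff_map, coeff_one_X_sq_sub_C_mul_X_add_C',
    Literature.NumberTheory.EllipticCurves.ModularForms.heckePolynomial,
    coeff_one_X_sq_sub_C_mul_X_add_C', map_neg, map_neg, neg_inj, htr, map_intCast,
    ← map_intCast ι] at h1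
  have h2 := congrArg Subtype.val (ι.injective h1)
  change (((W.frobeniusTraceAt v : ℤ) : coeffCharField f) : ℂ) =
    (UpperHalfPlane.qExpansion 1 ⇑f).coeff (primesEquiv v : ℕ) at h2
  rw [cuspCoeff, hcoe, W.lFunction_primesEquiv_eq_frobeniusTraceAt hgoodv, ← h2]
  norm_cast

/-- **M1 (NEW; strong multiplicity one across levels, coefficient form; S ≈ 25 lines — PROVED here).**
Two `Γ₀` newforms of weight `2` whose prime coefficients agree off a finite modulus have the same
level and the same `q`-expansion. -/
theorem level_eq_and_cuspCoeff_eq_of_cuspCoeff_eq_off {N₁ N₂ : ℕ} [NeZero N₁] [NeZero N₂]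
    {f₁ : CuspForm (Gamma0 N₁) 2} {f₂ : CuspForm (Gamma0 N₂) 2} (hf₁ : IsNewform0 f₁)
    (hf₂ : IsNewform0 f₂) {M : ℕ} (hM : M ≠ 0)
    (h : ∀ p : ℕ, p.Prime → ¬ p ∣ M → cuspCoeff f₁ p = cuspCoeff f₂ p) :
    ∃ e : N₁ = N₂, ∀ n : ℕ, cuspCoeff f₁ n = cuspCoeff (e ▸ f₂) n := by
  have hfin : {p : ℕ | p.Prime ∧ heckeEigenvalue f₁ p ≠ heckeEigenvalue f₂ p}.Finite := by
    refine M.primeFactors.finite_toSet.subset ?_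
    rintro p ⟨hp, hne⟩
    refine (Nat.mem_primeFactors_of_ne_zero hM).mpr ⟨hp, ?_⟩
    by_contra hpM
    apply hne
    rw [heckeEigenvalue_eq_coeff_of_isNormalized hf₁.2.2 hp (hf₁.2.1 p hp),
      heckeEigenvalue_eq_coeff_of_isNormalized hf₂.2.2 hp (hf₂.2.1 p hp)]
    exact h p hp hpM
  have hN : N₁ = N₂ := IsNewform0.level_eq_of_heckeEigenvalue_eq_holds hf₁ hf₂ hfin
  subst hN
  refine ⟨rfl, fun n ↦ ?_⟩
  rw [IsNewform0.eq_of_heckeEigenvalue_eq_holds hf₁ hf₂ hfin]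

section PacketPort
open UpperHalfPlane

/-- A `Γ₀(M)`-newform is non-zero (`a₁ = 1`) — verbatim copy of the tree's
`IsNewform0.ne_zero_of_isNormalized` (`BCDTModularityTwistProofs`, unbuilt on the snapshot). [folklore] -/
theorem isNewform0_ne_zero_of_isNormalized {M : ℕ} [NeZero M] {k : ℤ} {g : CuspForm (Gamma0 M) k}
    (hg : IsNewform0 g) : g ≠ 0 := by
  intro h
  have h1 : cuspCoeff g 1 = 1 := hg.2.2
  rw [h, cuspCoeff_zero_form (one_mem_strictPeriods_gamma0 M)] at h1
  exact zero_ne_one h1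

/-- **An integral newform packet makes `ρ̄` modular** — VERBATIM copy of the tree's
`Literature.NumberTheory.Automorphic.BCDT.isModular_of_isNewform0_packet`
(`BCDTModularityTwistProofs`, l. 134), inlined only because that module is unbuilt on the current
farm snapshot (`remote:stale:…:unbuilt`); a prover cites the tree decl instead.
[cite: BCDTJAMS2001, Introduction ("ρ̄ is modular")] [cite: DiamondShurman2005, Def. 9.6.4] -/
theorem isModular_of_isNewform0_packet' {M : ℕ} [NeZero M] {g : CuspForm (Gamma0 M) 2}
    (hg : IsNewform0 g) {ℓ : ℕ} [Fact ℓ.Prime] {b : ℕ → ℤ}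
    (hb : ∀ p : ℕ, p.Prime → ¬ p ∣ M * ℓ → cuspCoeff g p = (b p : ℂ))
    {ρ : ModPGaloisRep ℚ (ZMod ℓ) 2}
    (hρ : ∀ v : HeightOneSpectrum (𝓞 ℚ), ¬ ((primesEquiv v : ℕ) ∣ M * ℓ) →
      ρ.IsUnramifiedAt v ∧ ρ.HasFrobCharpolyAt v
        (X ^ 2 - C ((b (primesEquiv v : ℕ) : ℤ) : ZMod ℓ) * X + C ((primesEquiv v : ℕ) : ZMod ℓ))) :
    ρ.IsModular := by
  classical
  have hℓp : ℓ.Prime := Fact.out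
  have hgne : g ≠ 0 := isNewform0_ne_zero_of_isNormalized hg
  -- the newform on `Γ₁(M)` with trivial character
  set f₁ : CuspForm (Gamma1 M) 2 := liftToGamma1 M 2 g with hf₁
  have hnew : IsNewform1 f₁ := (isNewform1_liftToGamma1_iff_holds M 2 g).mpr hg
  have hcoe : (⇑f₁ : ℍ → ℂ) = ⇑g := coe_liftToGamma1_holds _ 2 g
  have hε : nebentypus f₁ = 1 := nebentypus_liftToGamma1_holds _ 2 hgne
  -- a prime `𝔪` of the coefficient ring `𝓞_f` above `ℓ`, and `K = 𝓞_f / 𝔪 ⊇ 𝔽_ℓ`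
  haveI : Algebra.IsIntegral ℤ (coeffCharIntegers f₁) := by
    unfold coeffCharIntegers; infer_instance
  haveI hmax : (Ideal.span {(ℓ : ℤ)}).IsMaximal :=
    PrincipalIdealRing.isMaximal_of_irreducible (Nat.prime_iff_prime_int.mp hℓp).irreducible
  obtain ⟨𝔪, h𝔪max, h𝔪⟩ := Ideal.exists_ideal_over_maximal_of_isIntegral
    (S := coeffCharIntegers f₁) (Ideal.span {(ℓ : ℤ)}) (fun x hx ↦ by
      rw [RingHom.mem_ker, eq_intCast, Int.cast_eq_zero] at hx
      rw [hx]; exact Ideal.zero_mem _)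
  haveI : 𝔪.IsMaximal := h𝔪max
  have hℓ𝔪 : ((ℓ : ℕ) : coeffCharIntegers f₁) ∈ 𝔪 := by
    have h : ((ℓ : ℕ) : ℤ) ∈ 𝔪.comap (algebraMap ℤ (coeffCharIntegers f₁)) := by
      rw [h𝔪]; exact Ideal.mem_span_singleton_self _
    rwa [Ideal.mem_comap, map_natCast] at h
  let K : Type := coeffCharIntegers f₁ ⧸ 𝔪
  letI : Field K := Ideal.Quotient.field 𝔪
  letI : TopologicalSpace K := ⊥
  haveI : DiscreteTopology K := ⟨rfl⟩
  have hℓK : ((ℓ : ℕ) : K) = 0 := by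
    rw [← map_natCast (Ideal.Quotient.mk 𝔪), Ideal.Quotient.eq_zero_iff_mem]
    exact hℓ𝔪
  haveI : CharP K ℓ := (CharP.charP_iff_prime_eq_zero hℓp).mpr hℓK
  let j : ZMod ℓ →+* K := ZMod.castHom (dvd_refl ℓ) K
  let ι : coeffCharIntegers f₁ →+* K := Ideal.Quotient.mk 𝔪
  refine ⟨M, inferInstance, 2, f₁, K, inferInstance, inferInstance, inferInstance, j, ι, by norm_num,
    hnew, ?_⟩
  -- `ρ̄ ⊗ K` is attached to `f₁` away from `M ℓ`
  intro v hv
  have hpp : (primesEquiv v : ℕ).Prime := (primesEquiv v).2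
  rw [ZMod.ringChar_zmod_n] at hv
  have hv' : ¬ ((primesEquiv v : ℕ) ∣ M * ℓ) := hv
  have hpM : ¬ (primesEquiv v : ℕ) ∣ M := fun h ↦ hv' (dvd_mul_of_dvd_left h _)
  obtain ⟨hunr, hfrob⟩ := hρ v hv'
  refine ⟨?_, ?_⟩
  · -- unramified at `p`
    intro 𝔓 h𝔓 τ hτ
    rw [FramedRep.baseChange_apply, hunr 𝔓 h𝔓 τ hτ, map_one]
  · -- the Hecke polynomial `X² - b_p X + p`, integrally, and the Frobenius characteristic polynomial
    have hap : (qExpansion 1 ⇑f₁).coeff (primesEquiv v : ℕ) = ((b (primesEquiv v : ℕ) : ℤ) : ℂ) := by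
      rw [hcoe]; exact hb _ hpp hv'
    have hεp : (nebentypus f₁ ((primesEquiv v : ℕ) : ZMod M) : ℂ) *
        ((primesEquiv v : ℕ) : ℂ) ^ ((2 : ℤ) - 1) = ((primesEquiv v : ℕ) : ℂ) := by
      rw [hε, MulChar.one_apply ((ZMod.isUnit_prime_iff_not_dvd hpp).mpr hpM), one_mul]
      norm_num
    have h1 : (⟨(qExpansion 1 ⇑f₁).coeff (primesEquiv v : ℕ),
        cuspCoeff_mem_coeffCharField f₁ (primesEquiv v : ℕ)⟩ : coeffCharField f₁) =
        ((b (primesEquiv v : ℕ) : ℤ) : coeffCharField f₁) :=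
      Subtype.ext (by
        change PowerSeries.coeff _ (qExpansion 1 ⇑f₁) = _
        rw [hap]; norm_cast)
    have h2 : (⟨(nebentypus f₁ ((primesEquiv v : ℕ) : ZMod M) : ℂ) *
        ((primesEquiv v : ℕ) : ℂ) ^ ((2 : ℤ) - 1),
        nebentypus_mul_zpow_mem_coeffCharField f₁ (primesEquiv v : ℕ)⟩ : coeffCharField f₁) =
        ((primesEquiv v : ℕ) : coeffCharField f₁) :=
      Subtype.ext (by
        change (nebentypus f₁ ((primesEquiv v : ℕ) : ZMod M) : ℂ) *
          ((primesEquiv v : ℕ) : ℂ) ^ ((2 : ℤ) - 1) = _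
        rw [hεp]; norm_cast)
    refine ⟨X ^ 2 - C ((b (primesEquiv v : ℕ) : ℤ) : coeffCharIntegers f₁) * X +
      C ((primesEquiv v : ℕ) : coeffCharIntegers f₁), ?_, ?_⟩
    · rw [Polynomial.map_add, Polynomial.map_sub, Polynomial.map_mul, Polynomial.map_pow,
        Polynomial.map_X, Polynomial.map_C, Polynomial.map_C, map_intCast, map_natCast,
        Literature.NumberTheory.EllipticCurves.ModularForms.heckePolynomial, h1, h2]
    · intro 𝔓 h𝔓 σ hσ
      have hch := hfrob 𝔓 h𝔓 σ hσ
      have hmap : (Units.val (Matrix.GeneralLinearGroup.map j (ρ σ)) : Matrix (Fin 2) (Fin 2) K) =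
          ((ρ σ : GL (Fin 2) (ZMod ℓ)) : Matrix (Fin 2) (Fin 2) (ZMod ℓ)).map j := rfl
      simp only [FramedRep.charpoly, FramedRep.baseChange_apply] at hch ⊢
      rw [hmap, Matrix.charpoly_map, hch]
      simp only [Polynomial.map_add, Polynomial.map_sub, Polynomial.map_mul, Polynomial.map_pow,
        Polynomial.map_X, Polynomial.map_C]
      rw [map_intCast j, map_natCast j, map_intCast ι, map_natCast ι]

end PacketPort

/-- **M2 (= gen-3 H1; UNCONDITIONAL — PROVED).**  `ρ_{E,ℓ}` modular ⇒ every framed model of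
`E[ℓ]` is modular — SAME prime, so no `ℓ`-hole: the packet of `IsModularGaloisRepTate ℓ` is off `N ℓ`,
exactly the exceptional set of `ModPGaloisRep.IsModular`.  M0 feeds the tree's
`isModular_of_isNewform0_packet` with `b p := a_p(E)`; the curve side (unramified + Frobenius polynomial
mod `ℓ` at the good places off `N ℓ`) is the body of `IsModular.exists_isNewform0_packet` with the
conductor replaced by `N`.  Generalises `IsModular.isModular_of_isTorsionGaloisRep''`
(`BCDT.IsModular W` weakened to `W.IsModularGaloisRepTate ℓ`). -/
theorem isModular_torsion_of_isModularGaloisRepTate_self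
    (W : WeierstrassCurve ℚ) [W.IsElliptic] (ℓ : ℕ) [Fact ℓ.Prime] (h : W.IsModularGaloisRepTate ℓ)
    {ρ : ModPGaloisRep ℚ (ZMod ℓ) 2} (hρ : W.IsTorsionGaloisRep ℓ ρ) : ρ.IsModular := by
  have hℓp : ℓ.Prime := Fact.out
  obtain ⟨N, hN, f₀, hf₀, hgoodN, hap⟩ :=
    exists_isNewform0_hasGoodReductionAt_of_isModularGaloisRepTate W ℓ h
  have htr := W.trace_galoisRepTate_frobenius_of_hasGoodReductionAt_holds ℓ
  have hdet : W.det_galoisRepTate_frobenius_of_hasGoodReductionAt ℓ :=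
    det_galoisRepTate_frobenius_of_hasGoodReductionAt_of_exists_weilPairing
      fun _ ↦ W.exists_weilPairing_holds _
  refine isModular_of_isNewform0_packet' hf₀ (b := fun p ↦ W.LFunction p)
    (fun p hp hpN ↦ hap p hp hpN) fun v hv ↦ ?_
  have hpp : (primesEquiv v : ℕ).Prime := (primesEquiv v).2
  have hpℓ : (primesEquiv v : ℕ) ≠ ℓ := fun h' ↦ hv (by rw [← h']; exact dvd_mul_left _ _)
  have hgood : W.HasGoodReductionAt v := hgoodN v hv
  have hℓv : ((ℓ : ℕ) : 𝓞 ℚ) ∉ v.asIdeal := by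
    rw [Literature.NumberTheory.GaloisRepresentations.Rat.natCast_mem_asIdeal_iff]
    exact fun h' ↦ hpℓ ((Nat.prime_dvd_prime_iff_eq hpp hℓp).mp h')
  refine ⟨hρ.isUnramifiedAt_of_hasGoodReductionAt hgood hℓv, ?_⟩
  intro 𝔓 h𝔓 σ hσ
  have hch := hρ.charpoly_eq_of_isArithFrobAt htr hdet hℓv hgood h𝔓 hσ
  rw [natCard_residueField_adicCompletionIntegers,
    ← W.lFunction_primesEquiv_eq_frobeniusTraceAt hgood] at hch
  exact hch

/-! ## Port of ideator-1's PROVED gen-3 blocks (verbatim from `STUB_IDEAS_stub_threeImpTwo_1_Sketch.lean`,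
namespace `…StubIdeasThreeImpTwo1`, lines 192–424, 705–754, 955–1080; `lean check` rc 0 / 0 sorries
re-verified 2026-08-31T19:5xZ).  Landing target (2) of the card: one Theorems file. -/

section PortK1
/-- **H3 (Carayol Euler factors transported to `E`).**  For every place `v ∤ p'`:
`L_v(E, T) = 1 - a_q(f₀) T + ε(q) q T²` in `ℂ[T]` (`q = p_v`, `ε = 𝟙_N` the nebentypus of the
lift).  `f`-side: `Carayol1986_eulerFactor` on `ρ_g`; transport along the equivalence of H2
(`ContinuousRep.inertiaCoinvariantsCongr_conj_toInertiaCoinvariants`, `LinearEquiv.charpoly_conj`),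
along base change (`charpoly_toCoinvariants_map`) and along `eV` to `V_{p'}(E)`; `E`-side: the
PROVED `reverse_charpoly_toInertiaCoinvariants_eq_localPolynomialAt'` (all reduction types). -/
theorem H3_map_localPolynomialAt_eq (hCE : Carayol1986_eulerFactor)
    (W : WeierstrassCurve ℚ) [W.IsElliptic] {N : ℕ} [NeZero N] (f₀ : CuspForm (Gamma0 N) 2)
    (hf₀ : IsNewform0 f₀) (p' : ℕ) [Fact p'.Prime] (ι : PadicAlgCl p' ≃+* ℂ)
    (ρg : FramedGaloisRep ℚ (PadicAlgCl p') 2)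
    (hρg : IsGaloisRepOfNewform1 (liftToGamma1 N 2 f₀)
      ((ι.symm : ℂ →+* PadicAlgCl p').comp (algebraMap (coeffCharField (liftToGamma1 N 2 f₀)) ℂ))
      {q | q ∣ N * p'} ρg)
    (hirr : ρg.toGaloisRep.IsIrreducible)
    (VQ : FramedGaloisRep ℚ ℚ_[p'] 2) (eV : (Fin 2 → ℚ_[p']) ≃ₗ[ℚ_[p']] W.rationalTateModule p')
    (heV : ∀ (σ : absoluteGaloisGroup ℚ) (x : Fin 2 → ℚ_[p']),
      eV (FramedRep.toRepresentation VQ σ x) = W.rationalGaloisRepTate p' σ (eV x))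
    (he : Nonempty (ContinuousRep.Equiv ρg.toGaloisRep
      (FramedGaloisRep.toGaloisRep
        (VQ.baseChange (algebraMap ℚ_[p'] (PadicAlgCl p')) (continuous_algebraMap_padicAlgCl p')))))
    (v : HeightOneSpectrum (𝓞 ℚ)) (hv : (p' : 𝓞 ℚ) ∉ v.asIdeal) :
    (W.localPolynomialAt v).map (Int.castRingHom ℂ) =
      1 - C (cuspCoeff f₀ (primesEquiv v : ℕ)) * X +
        C ((nebentypus (liftToGamma1 N 2 f₀) ((primesEquiv v : ℕ) : ZMod N) : ℂ) *
          ((primesEquiv v : ℕ) : ℂ)) * X ^ 2 := by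
  classical
  haveI := W.module_finite_rationalTateModule_holds p'
  have hq : (primesEquiv v : ℕ).Prime := (primesEquiv v).2
  have hqv : ((primesEquiv v : ℕ) : 𝓞 ℚ) ∈ v.asIdeal := by
    rw [Literature.NumberTheory.GaloisRepresentations.Rat.natCast_mem_asIdeal_iff]
    exact dvd_of_eq (show natGenerator v = (primesEquiv v : ℕ) from rfl)
  have hqp' : (primesEquiv v : ℕ) ≠ p' := fun h ↦ hv (h ▸ hqv)
  -- a prime `𝔔 ∣ v` of `ℤ̄` and an arithmetic Frobenius `σ ∈ D_𝔔`
  obtain ⟨𝔔, h𝔔⟩ := primesAbove_nonempty v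
  haveI : 𝔔.IsPrime := h𝔔.1
  obtain ⟨σ₀, hσ₀⟩ := exists_isArithFrobAt_of_mem_primesAbove_holds (v := v) h𝔔
  set σ : 𝔔.decompositionSubgroup (absoluteGaloisGroup ℚ) := ⟨σ₀, hσ₀.mem_stabilizer⟩ with hσdef
  have hσ : IsArithFrobAt (𝓞 ℚ) (σ : absoluteGaloisGroup ℚ) 𝔔 := hσ₀
  -- (1) Carayol's theorem for `ρ_g`, `g` the lift of `f₀`
  have hnew : IsNewform1 (liftToGamma1 N 2 f₀) :=
    (isNewform1_liftToGamma1_iff_holds (N := N) (k := 2) f₀).mpr hf₀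
  have h1 := hCE (liftToGamma1 N 2 f₀) le_rfl hnew p' ι ρg hρg hirr (primesEquiv v : ℕ) hq hqp' v
    hqv 𝔔 h𝔔 σ hσ
  -- (2) `ρ_g ≅ V ⊗ ℚ̄_{p'}`: isomorphic representations have the same coinvariant charpolys
  obtain ⟨e⟩ := he
  have he' : ∀ (γ : absoluteGaloisGroup ℚ) (x : Fin 2 → PadicAlgCl p'),
      e.toLinearEquiv (ρg.toGaloisRep γ x) = (FramedGaloisRep.toGaloisRep
        (VQ.baseChange (algebraMap ℚ_[p'] (PadicAlgCl p')) (continuous_algebraMap_padicAlgCl p')))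
          γ (e.toLinearEquiv x) :=
    fun γ x ↦ LinearMap.congr_fun (e.isIntertwining' γ) x
  have hconj := ContinuousRep.inertiaCoinvariantsCongr_conj_toInertiaCoinvariants _ _
    e.toLinearEquiv he' 𝔔 σ
  have h2 : ((FramedGaloisRep.toGaloisRep (VQ.baseChange (algebraMap ℚ_[p'] (PadicAlgCl p'))
      (continuous_algebraMap_padicAlgCl p'))).toInertiaCoinvariants 𝔔 σ).charpoly =
      (ρg.toGaloisRep.toInertiaCoinvariants 𝔔 σ).charpoly := by
    rw [← hconj, LinearEquiv.charpoly_conj]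
  rw [← h2] at h1
  -- (3) coinvariants commute with the base change `ℚ_{p'} → ℚ̄_{p'}`
  have hbc : ((FramedGaloisRep.toGaloisRep (VQ.baseChange (algebraMap ℚ_[p'] (PadicAlgCl p'))
      (continuous_algebraMap_padicAlgCl p'))).toInertiaCoinvariants 𝔔 σ).charpoly =
      (((FramedGaloisRep.toGaloisRep VQ).toInertiaCoinvariants 𝔔 σ).charpoly).map
        (algebraMap ℚ_[p'] (PadicAlgCl p')) :=
    charpoly_toCoinvariants_map (algebraMap ℚ_[p'] (PadicAlgCl p'))
      ((VQ : absoluteGaloisGroup ℚ →* GL (Fin 2) ℚ_[p']).comp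
        (𝔔.decompositionSubgroup (absoluteGaloisGroup ℚ)).subtype)
      (𝔔.inertia (𝔔.decompositionSubgroup (absoluteGaloisGroup ℚ))) σ
  have hrev : ∀ {P : ℚ_[p'][X]}, P.Monic →
      (P.map (algebraMap ℚ_[p'] (PadicAlgCl p'))).reverse =
        P.reverse.map (algebraMap ℚ_[p'] (PadicAlgCl p')) := fun hP ↦ by
    rw [Polynomial.reverse, Polynomial.reverse, hP.natDegree_map, Polynomial.reflect_map]
  rw [hbc, hrev (LinearMap.charpoly_monic _)] at h1
  -- (4) the framing `V ≅ V_{p'}(E)` and the `E`-side Euler factor `L_v(E, T)`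
  have hcW := W.continuous_rationalGaloisRepTate_holds p'
  have heV' : ∀ (γ : absoluteGaloisGroup ℚ) (x : Fin 2 → ℚ_[p']),
      eV ((FramedGaloisRep.toGaloisRep VQ) γ x) =
        (rationalTateGaloisRepOf (geomPoints W) p' hcW) γ (eV x) := fun γ x ↦ heV γ x
  have hconj₂ := ContinuousRep.inertiaCoinvariantsCongr_conj_toInertiaCoinvariants _ _ eV heV' 𝔔 σ
  have h3 : ((rationalTateGaloisRepOf (geomPoints W) p' hcW).toInertiaCoinvariants 𝔔 σ).charpoly =
      ((FramedGaloisRep.toGaloisRep VQ).toInertiaCoinvariants 𝔔 σ).charpoly := by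
    rw [← hconj₂, LinearEquiv.charpoly_conj]
  have hE := W.reverse_charpoly_toInertiaCoinvariants_eq_localPolynomialAt' p' hv h𝔔 σ hσ
  rw [h3] at hE
  rw [hE, Polynomial.map_map] at h1
  -- (5) read everything in `ℂ` through `ι`
  have h4 := congrArg (Polynomial.map (ι : PadicAlgCl p' →+* ℂ)) h1
  rw [Polynomial.map_map, RingHom.eq_intCast' (((ι : PadicAlgCl p' →+* ℂ).comp
    ((algebraMap ℚ_[p'] (PadicAlgCl p')).comp (Int.castRingHom ℚ_[p']))))] at h4
  rw [h4]
  have h21 : ((2 : ℤ) - 1) = 1 := by norm_num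
  have hcc : cuspCoeff (liftToGamma1 N 2 f₀) (primesEquiv v : ℕ) = cuspCoeff f₀ (primesEquiv v : ℕ) := by
    rw [cuspCoeff, cuspCoeff, coe_liftToGamma1_holds N 2 f₀]
  simp only [Polynomial.map_add, Polynomial.map_sub, Polynomial.map_mul, Polynomial.map_pow,
    Polynomial.map_one, map_X, map_C, RingEquiv.coe_toRingHom, RingEquiv.apply_symm_apply, h21,
    zpow_one, hcc]

/-- The `X`-coefficient of `1 - a X + b X²` is `-a`. [folklore] -/
theorem coeff_quad_one {S : Type*} [CommRing S] (a b : S) :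
    (1 - C a * X + C b * X ^ 2 : S[X]).coeff 1 = -a := by
  simp [Polynomial.coeff_one, Polynomial.coeff_X_pow, Polynomial.coeff_C, Polynomial.coeff_X]

/-- The `X²`-coefficient of `1 - a X + b X²` is `b`. [folklore] -/
theorem coeff_quad_two {S : Type*} [CommRing S] (a b : S) :
    (1 - C a * X + C b * X ^ 2 : S[X]).coeff 2 = b := by
  simp [Polynomial.coeff_one, Polynomial.coeff_X_pow, Polynomial.coeff_C, Polynomial.coeff_X]

/-- **H4 (read off both coefficients).**  From the local identity of H3 at `v`:
`a_q(f₀) = a_q(E)` (the `T`-coefficient of `L_v(E,T)` is `-a_q(E)` for every reduction type: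
`localPolynomialAt_of_hasGoodReductionAt` / `…SplitMultiplicative…` / `…not_hasSplit…` /
`…Additive…` with `LFunction_apply_primesEquiv_of_has…ReductionAt`) and `q ∣ N ↔ q ∣ N_E` (the
`T²`-coefficient is `q` iff good reduction iff `q ∤ N_E` (`dvd_conductorNorm_iff`), and
`ε(q) q = q` iff `q ∤ N`, else `0`, by `nebentypus_liftToGamma1_holds`). -/
theorem H4_cuspCoeff_eq_and_dvd_iff (W : WeierstrassCurve ℚ) [W.IsElliptic] {N : ℕ} [NeZero N]
    (f₀ : CuspForm (Gamma0 N) 2) (hf₀ : IsNewform0 f₀) (v : HeightOneSpectrum (𝓞 ℚ))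
    (hloc : (W.localPolynomialAt v).map (Int.castRingHom ℂ) =
      1 - C (cuspCoeff f₀ (primesEquiv v : ℕ)) * X +
        C ((nebentypus (liftToGamma1 N 2 f₀) ((primesEquiv v : ℕ) : ZMod N) : ℂ) *
          ((primesEquiv v : ℕ) : ℂ)) * X ^ 2) :
    cuspCoeff f₀ (primesEquiv v : ℕ) = (W.LFunction (primesEquiv v : ℕ) : ℂ) ∧
      ((primesEquiv v : ℕ) ∣ N ↔ (primesEquiv v : ℕ) ∣ W.conductorNorm ℤ) := by
  classical
  have hqp : (primesEquiv v : ℕ).Prime := (primesEquiv v).2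
  have hqC : ((primesEquiv v : ℕ) : ℂ) ≠ 0 := Nat.cast_ne_zero.mpr hqp.ne_zero
  have hf0 : f₀ ≠ 0 := IsNormalized.ne_zero hf₀.2.2
  -- the value `ε(q)` of the (trivial mod `N`) nebentypus of the lift
  have hε0 : (primesEquiv v : ℕ) ∣ N →
      nebentypus (liftToGamma1 N 2 f₀) ((primesEquiv v : ℕ) : ZMod N) = 0 := fun hqN ↦ by
    rw [nebentypus_liftToGamma1_holds (N := N) (k := 2) hf0]
    exact MulChar.map_nonunit _ (by
      rwa [ZMod.isUnit_iff_coprime, hqp.coprime_iff_not_dvd, not_not])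
  have hε1 : ¬ (primesEquiv v : ℕ) ∣ N →
      nebentypus (liftToGamma1 N 2 f₀) ((primesEquiv v : ℕ) : ZMod N) = 1 := fun hqN ↦ by
    rw [nebentypus_liftToGamma1_holds (N := N) (k := 2) hf0]
    exact MulChar.one_apply ((ZMod.isUnit_iff_coprime _ N).mpr (hqp.coprime_iff_not_dvd.mpr hqN))
  -- the two coefficients of the identity `hloc`
  have h1 := congrArg (fun P : ℂ[X] ↦ P.coeff 1) hloc
  have h2 := congrArg (fun P : ℂ[X] ↦ P.coeff 2) hloc
  simp only [Polynomial.coeff_map, eq_intCast, coeff_quad_one, coeff_quad_two] at h1 h2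
  rw [W.dvd_conductorNorm_iff v]
  obtain hG | hM | hA :=
    hasGoodReductionAt_or_hasMultiplicativeReductionAt_or_hasAdditiveReductionAt (W := W) (v := v)
  · -- good reduction: `L_v = 1 - a_v X + q X²`
    rw [localPolynomialAt_of_hasGoodReductionAt hG] at h1 h2
    rw [coeff_quad_one] at h1
    rw [coeff_quad_two, natCard_residueField_eq_residueCard] at h2
    refine ⟨?_, ?_⟩
    · rw [W.lFunction_primesEquiv_eq_frobeniusTraceAt hG]
      -- h1 : ((-t : ℤ) : ℂ) = - a
      push_cast at h1
      first | linear_combination h1 | linear_combination -h1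
    · refine iff_of_false (fun hqN ↦ ?_) (not_not.mpr hG)
      rw [hε0 hqN, zero_mul] at h2
      have h1lt := one_lt_residueCard v
      have : (v.residueCard : ℂ) = 0 := by exact_mod_cast h2
      exact absurd (by exact_mod_cast this : v.residueCard = 0) (by omega)
  · -- multiplicative reduction: `L_v = 1 ∓ X`
    have hbad : ¬ W.HasGoodReductionAt v := hM.not_hasGoodReductionAt
    by_cases hs : W.HasSplitMultiplicativeReductionAt v
    · rw [localPolynomialAt_of_hasSplitMultiplicativeReductionAt hs] at h1 h2
      simp only [coeff_sub, coeff_one, coeff_X, if_neg (one_ne_zero), if_pos rfl] at h1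
      simp only [coeff_sub, coeff_one, coeff_X] at h2
      norm_num at h1 h2
      refine ⟨?_, iff_of_true ?_ hbad⟩
      · rw [W.LFunction_apply_primesEquiv_of_hasSplitMultiplicativeReductionAt hs]
        push_cast
        first | linear_combination h1 | linear_combination -h1
      · by_contra hqN
        exact one_ne_zero ((hε1 hqN).symm.trans (h2.resolve_right (by exact_mod_cast hqp.ne_zero)))
    · rw [localPolynomialAt_of_hasMultiplicativeReductionAt_of_not_hasSplitMultiplicativeReductionAt
        hM hs] at h1 h2
      simp only [coeff_add, coeff_one, coeff_X] at h1 h2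
      norm_num at h1 h2
      refine ⟨?_, iff_of_true ?_ hbad⟩
      · rw [W.LFunction_apply_primesEquiv_of_hasMultiplicativeReductionAt_of_not_split hM hs]
        push_cast
        first | linear_combination h1 | linear_combination -h1
      · by_contra hqN
        exact one_ne_zero ((hε1 hqN).symm.trans (h2.resolve_right (by exact_mod_cast hqp.ne_zero)))
  · -- additive reduction: `L_v = 1`
    have hbad : ¬ W.HasGoodReductionAt v := hA.not_hasGoodReductionAt
    rw [localPolynomialAt_of_hasAdditiveReductionAt hA] at h1 h2
    simp only [coeff_one] at h1 h2
    norm_num at h1 h2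
    refine ⟨?_, iff_of_true ?_ hbad⟩
    · rw [W.LFunction_apply_primesEquiv_of_hasAdditiveReductionAt hA]
      push_cast
      first | linear_combination h1 | linear_combination -h1
    · by_contra hqN
      exact one_ne_zero ((hε1 hqN).symm.trans (h2.resolve_right (by exact_mod_cast hqp.ne_zero)))

/-- H5, prime powers: `a_{p^e}(f₀) = a_{p^e}(E)` from `a_p(f₀) = a_p(E)` and `p ∣ N ↔ p ∣ N_E`
(the two-step recursions `IsNewform0.cuspCoeff_prime_pow_add_two` and
`LFunction_apply_prime_pow_add_two_of_prime` have the same indicator). -/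
theorem H5aux_cuspCoeff_prime_pow_eq_lFunction (W : WeierstrassCurve ℚ) [W.IsElliptic]
    [NeZero (W.conductorNorm ℤ)] {N : ℕ} [NeZero N] {f₀ : CuspForm (Gamma0 N) 2}
    (hf : IsNewform0 f₀) {p : ℕ} (hp : p.Prime) (hpd : p ∣ N ↔ p ∣ W.conductorNorm ℤ)
    (hfp : cuspCoeff f₀ p = (W.LFunction p : ℂ)) :
    ∀ e : ℕ, cuspCoeff f₀ (p ^ e) = (W.LFunction (p ^ e) : ℂ)
  | 0 => by
    rw [pow_zero, W.isMultiplicative_LFunction.map_one, Int.cast_one]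
    exact hf.2.2
  | 1 => by rwa [pow_one]
  | e + 2 => by
    rw [hf.cuspCoeff_prime_pow_add_two hp e, W.LFunction_apply_prime_pow_add_two_of_prime hp e,
      H5aux_cuspCoeff_prime_pow_eq_lFunction W hf hp hpd hfp e,
      H5aux_cuspCoeff_prime_pow_eq_lFunction W hf hp hpd hfp (e + 1), hfp]
    by_cases h : p ∣ N
    · rw [if_pos h, if_pos (hpd.mp h)]; push_cast; ring
    · rw [if_neg h, if_neg fun h' ↦ h (hpd.mpr h')]; push_cast; ring

/-- **H5 (Hecke assembly at level `N`).**  `isNewformOf_of_forall_prime_cuspCoeff_eq`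
(`ModularityVersionAp`, typed at level `N_E`) generalised to level `N` under
`∀ p, p ∣ N ↔ p ∣ N_E`: prime powers by `H5aux_cuspCoeff_prime_pow_eq_lFunction`, then
multiplicativity (`IsNewform0.coeff_mul_of_coprime_holds`, `isMultiplicative_LFunction`,
`Nat.recOnPosPrimePosCoprime`).  PROVED. -/
theorem H5_isNewformOf_of_forall_prime_cuspCoeff_eq_of_dvd_iff (W : WeierstrassCurve ℚ) [W.IsElliptic]
    [NeZero (W.conductorNorm ℤ)] {N : ℕ} [NeZero N] {f₀ : CuspForm (Gamma0 N) 2} (hf₀ : IsNewform0 f₀)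
    (hdvd : ∀ p : ℕ, p.Prime → (p ∣ N ↔ p ∣ W.conductorNorm ℤ))
    (hfp : ∀ p : ℕ, p.Prime → cuspCoeff f₀ p = (W.LFunction p : ℂ)) : IsNewformOf W f₀ := by
  refine ⟨hf₀, fun n ↦ ?_⟩
  induction n using Nat.recOnPosPrimePosCoprime with
  | prime_pow p e hp _ =>
    exact H5aux_cuspCoeff_prime_pow_eq_lFunction W hf₀ hp (hdvd p hp) (hfp p hp) e
  | zero =>
    rw [ArithmeticFunction.map_zero, Int.cast_zero]
    exact CuspFormClass.qExpansion_coeff_zero f₀ one_pos (one_mem_strictPeriods_gamma0 _)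
  | one =>
    rw [W.isMultiplicative_LFunction.map_one, Int.cast_one]
    exact hf₀.2.2
  | coprime a b _ _ hab iha ihb =>
    have h := IsNewform0.coeff_mul_of_coprime_holds hf₀ hab
    simp only [cuspCoeff] at iha ihb ⊢
    rw [h, W.isMultiplicative_LFunction.map_mul_of_coprime hab, Int.cast_mul, iha, ihb]


/-- **H2′ (recognition with `ρ_g` as INPUT)** — the body of H2 after its first line: any irreducible
`ρ_g` attached to the lift of `f₀` off `N p'` is isomorphic to `V_{p'}(E) ⊗ ℚ̄_{p'}` as soon as
`a_p(f₀) = a_p(E)` off a finite set (`nonempty_equiv_twist_of_isGaloisRepOfNewform1` at `ψ = 1`).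
PROVED. -/
theorem H2'_equiv_of_isGaloisRepOfNewform1
    (W : WeierstrassCurve ℚ) [W.IsElliptic] {N : ℕ} [NeZero N] (f₀ : CuspForm (Gamma0 N) 2)
    (hf₀ : IsNewform0 f₀) {T₀ : ℕ} (hT₀ : T₀ ≠ 0)
    (hfp : ∀ p : ℕ, p.Prime → ¬ p ∣ T₀ → cuspCoeff f₀ p = (W.LFunction p : ℂ))
    (p' : ℕ) [Fact p'.Prime] (ι : PadicAlgCl p' ≃+* ℂ) (VQ : FramedGaloisRep ℚ ℚ_[p'] 2)
    (hV : ∀ v : HeightOneSpectrum (𝓞 ℚ), (p' : 𝓞 ℚ) ∉ v.asIdeal → W.HasGoodReductionAt v →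
      FramedGaloisRep.IsUnramifiedAt v VQ ∧
        FramedGaloisRep.HasFrobCharpolyAt v
          (X ^ 2 - C ((W.LFunction (primesEquiv v : ℕ) : ℤ) : ℚ_[p']) * X +
            C ((primesEquiv v : ℕ) : ℚ_[p'])) VQ)
    (ρg : FramedGaloisRep ℚ (PadicAlgCl p') 2)
    (hρg : IsGaloisRepOfNewform1 (liftToGamma1 N 2 f₀)
      ((ι.symm : ℂ →+* PadicAlgCl p').comp (algebraMap (coeffCharField (liftToGamma1 N 2 f₀)) ℂ))
      {q | q ∣ N * p'} ρg)
    (hirr : ρg.toGaloisRep.IsIrreducible) :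
    Nonempty (ContinuousRep.Equiv ρg.toGaloisRep
      (FramedGaloisRep.toGaloisRep
        (VQ.baseChange (algebraMap ℚ_[p'] (PadicAlgCl p')) (continuous_algebraMap_padicAlgCl p')))) := by
  classical
  have hf0 : f₀ ≠ 0 := IsNormalized.ne_zero hf₀.2.2
  have hg : ∀ p : ℕ, p.Prime → ¬ p ∣ T₀ * N →
      cuspCoeff (liftToGamma1 N 2 f₀) p = (fun _ : ℕ ↦ (1 : ℂ)) p * (W.LFunction p : ℂ) ∧
        (nebentypus (liftToGamma1 N 2 f₀) (p : ZMod N) : ℂ) = (fun _ : ℕ ↦ (1 : ℂ)) p ^ 2 := by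
    intro p hp hpT
    have hpT₀ : ¬ p ∣ T₀ := fun h ↦ hpT (dvd_mul_of_dvd_left h _)
    have hpN : ¬ p ∣ N := fun h ↦ hpT (dvd_mul_of_dvd_right h _)
    refine ⟨?_, ?_⟩
    · rw [one_mul, ← hfp p hp hpT₀]
      rw [cuspCoeff, cuspCoeff, coe_liftToGamma1_holds N 2 f₀]
    · rw [nebentypus_liftToGamma1_holds (N := N) (k := 2) hf0, one_pow]
      have hu : IsUnit (p : ZMod N) :=
        (ZMod.isUnit_iff_coprime p N).mpr (hp.coprime_iff_not_dvd.mpr hpN)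
      rw [MulChar.one_apply hu]
  have hψI : ∀ v : HeightOneSpectrum (𝓞 ℚ), ¬ ((primesEquiv v : Nat.Primes) : ℕ) ∣ 1 →
      ∀ 𝔓 ∈ v.primesAbove, ∀ σ ∈ 𝔓.inertia (absoluteGaloisGroup ℚ),
        (1 : absoluteGaloisGroup ℚ →ₜ* (PadicAlgCl p')ˣ) σ = 1 := fun _ _ _ _ _ _ ↦ rfl
  have hψF : ∀ v : HeightOneSpectrum (𝓞 ℚ), ¬ ((primesEquiv v : Nat.Primes) : ℕ) ∣ 1 →
      ∀ 𝔓 ∈ v.primesAbove, ∀ σ : absoluteGaloisGroup ℚ, IsArithFrobAt (𝓞 ℚ) σ 𝔓 →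
        ((1 : absoluteGaloisGroup ℚ →ₜ* (PadicAlgCl p')ˣ) σ : PadicAlgCl p') =
          ι.symm ((fun _ : ℕ ↦ (1 : ℂ)) (primesEquiv v : ℕ)) := by
    intros; simp
  obtain ⟨e⟩ := nonempty_equiv_twist_of_isGaloisRepOfNewform1 W p' ι VQ hV 1 (fun _ ↦ (1 : ℂ)) 1
    hψI hψF (liftToGamma1 N 2 f₀) (mul_ne_zero hT₀ (NeZero.ne N)) hg ρg hρg hirr
  rw [FramedRep.twist_one] at e
  exact ⟨e⟩


/-- **Leaf `L_A` AT ONE NEWFORM** (gen-2's `RatNewformGaloisRepCofinal`, per `f₀`). -/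
def RatGaloisRepCofinalAt {N : ℕ} [NeZero N] (f₀ : CuspForm (Gamma0 N) 2) : Prop :=
  ∀ B : ℕ, ∃ (p : ℕ) (_ : Fact p.Prime), B < p ∧ ∀ ι : PadicAlgCl p ≃+* ℂ,
    ∃ ρ : FramedGaloisRep ℚ (PadicAlgCl p) 2,
      IsGaloisRepOfNewform1 (liftToGamma1 N 2 f₀)
        ((ι.symm : ℂ →+* PadicAlgCl p).comp (algebraMap (coeffCharField (liftToGamma1 N 2 f₀)) ℂ))
        {q | q ∣ N * p} ρ ∧
      ρ.toGaloisRep.IsIrreducible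

/-- **G3.B1 (`L_A` at `f₀` from ANY elliptic curve good off `N` carrying `a_p(f₀)` for `p ∤ N`)** —
gen-2's (ii) made per-newform: `ρ := V_p(E) ⊗ ℚ̄_p` for a prime `p > B` with `V_p(E)` irreducible
(`exists_prime_gt_isIrreducible_rationalGaloisRepTate`), absolutely irreducible by oddness. PROVED. -/
theorem ratGaloisRepCofinalAt_of_curve (W : WeierstrassCurve ℚ) [W.IsElliptic] {N : ℕ} [NeZero N]
    (f₀ : CuspForm (Gamma0 N) 2) (hf₀ : IsNewform0 f₀)
    (hgood : ∀ v : HeightOneSpectrum (𝓞 ℚ), ¬ ((primesEquiv v : ℕ) ∣ N) → W.HasGoodReductionAt v)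
    (hap : ∀ p : ℕ, p.Prime → ¬ p ∣ N → cuspCoeff f₀ p = (W.LFunction p : ℂ)) :
    RatGaloisRepCofinalAt f₀ := by
  classical
  intro B
  obtain ⟨p, hpF, hBp, hirrW⟩ := W.exists_prime_gt_isIrreducible_rationalGaloisRepTate B
  have hp : p.Prime := hpF.out
  refine ⟨p, hpF, hBp, fun ι ↦ ?_⟩
  obtain ⟨VQ, eV, heV, hV⟩ := exists_framedGaloisRep_rationalTate W p
  have hf0 : f₀ ≠ 0 := IsNormalized.ne_zero hf₀.2.2
  refine ⟨VQ.baseChange (algebraMap ℚ_[p] (PadicAlgCl p)) (continuous_algebraMap_padicAlgCl p),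
    fun v hv ↦ ?_, ?_⟩
  · -- attached to the lift of `f₀` off `N p`
    have hq : (primesEquiv v : ℕ).Prime := (primesEquiv v).2
    have hqNp : ¬ (primesEquiv v : ℕ) ∣ N * p := hv
    have hqN : ¬ (primesEquiv v : ℕ) ∣ N := fun h ↦ hqNp (dvd_mul_of_dvd_left h _)
    have hqp : (primesEquiv v : ℕ) ≠ p := fun h ↦ hqNp (h ▸ dvd_mul_left p N)
    have hpv : (p : 𝓞 ℚ) ∉ v.asIdeal := natCast_not_mem_asIdeal_of_primesEquiv_ne hp hqp
    obtain ⟨hur, hchar⟩ := hV v hpv (hgood v hqN)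
    refine ⟨(FramedGaloisRep.isUnramifiedAt_baseChange_iff _ _
      (algebraMap ℚ_[p] (PadicAlgCl p)).injective v VQ).mpr hur, ?_⟩
    have H := FramedGaloisRep.hasFrobCharpolyAt_baseChange (algebraMap ℚ_[p] (PadicAlgCl p))
      (continuous_algebraMap_padicAlgCl p) hchar
    have hcoeff : (UpperHalfPlane.qExpansion 1 ⇑(liftToGamma1 N 2 f₀)).coeff (primesEquiv v : ℕ) =
        ((W.LFunction (primesEquiv v : ℕ) : ℤ) : ℂ) := by
      rw [← hap _ hq hqN, cuspCoeff, coe_liftToGamma1_holds N 2 f₀]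
    have hε : nebentypus (liftToGamma1 N 2 f₀) ((primesEquiv v : ℕ) : ZMod N) = 1 := by
      rw [nebentypus_liftToGamma1_holds (N := N) (k := 2) hf0]
      exact MulChar.one_apply
        ((ZMod.isUnit_iff_coprime _ N).mpr (hq.coprime_iff_not_dvd.mpr hqN))
    have h21 : ((2 : ℤ) - 1) = 1 := by norm_num
    have hpoly : (heckePolynomial (liftToGamma1 N 2 f₀) (primesEquiv v : Nat.Primes)).map
        ((ι.symm : ℂ →+* PadicAlgCl p).comp
          (algebraMap (coeffCharField (liftToGamma1 N 2 f₀)) ℂ)) =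
        (X ^ 2 - C ((W.LFunction (primesEquiv v : ℕ) : ℤ) : ℚ_[p]) * X +
          C ((primesEquiv v : ℕ) : ℚ_[p])).map (algebraMap ℚ_[p] (PadicAlgCl p)) := by
      rw [← Polynomial.map_map, map_heckePolynomial, hcoeff, hε, one_mul, h21, zpow_one]
      simp only [Polynomial.map_add, Polynomial.map_sub, Polynomial.map_mul, Polynomial.map_pow,
        Polynomial.map_X, map_intCast, map_natCast, Polynomial.map_intCast, Polynomial.map_natCast]
    rw [hpoly]
    exact H
  · -- irreducible over `ℚ̄_p`: `V_p(E)` is irreducible (choice of `p`) and odd (Weil pairing)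
    obtain ⟨c, hc⟩ := exists_isComplexConjugation (Rat.castHom ℝ)
    have hcc : c * c = 1 := by rw [← pow_two]; exact hc.sq_eq_one
    have hirrVQ : FramedRep.IsIrreducible VQ :=
      (Representation.isIrreducible_iff_of_equivariant (FramedRep.toRepresentation VQ)
        (W.rationalGaloisRepTate p) (MonoidHom.id _) Function.surjective_id eV
        (fun g x ↦ by rw [MonoidHom.id_apply]; exact heV g x)).mpr hirrW
    have hconj : FramedRep.toRepresentation VQ c =
        (eV.symm : W.rationalTateModule p →ₗ[ℚ_[p]] (Fin 2 → ℚ_[p])) ∘ₗ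
          (W.rationalGaloisRepTate p c : W.rationalTateModule p →ₗ[ℚ_[p]] W.rationalTateModule p) ∘ₗ
            (eV : (Fin 2 → ℚ_[p]) →ₗ[ℚ_[p]] W.rationalTateModule p) := by
      refine LinearMap.ext fun x ↦ ?_
      simp only [LinearMap.coe_comp, Function.comp_apply, LinearEquiv.coe_coe]
      rw [LinearEquiv.eq_symm_apply, heV]
    have h1 : LinearMap.det (FramedRep.toRepresentation VQ c) = -1 := by
      rw [hconj]
      have h := LinearMap.det_conj
        (W.rationalGaloisRepTate p c : W.rationalTateModule p →ₗ[ℚ_[p]] W.rationalTateModule p) eV.symm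
      rw [LinearEquiv.symm_symm] at h
      rw [h]
      exact Literature.AlgebraicGeometry.Motives.det_rationalGaloisRepTate_of_isComplexConjugation W p hc
    have h2 : FramedRep.toRepresentation VQ c =
        Matrix.toLin' ((VQ c : GL (Fin 2) ℚ_[p]) : Matrix (Fin 2) (Fin 2) ℚ_[p]) :=
      LinearMap.ext fun x ↦ by rw [FramedRep.toRepresentation_apply_apply, Matrix.toLin'_apply]
    have hdet : Matrix.GeneralLinearGroup.det (VQ c) = -1 := by
      ext
      rw [Matrix.GeneralLinearGroup.val_det_apply, Units.val_neg, Units.val_one,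
        ← LinearMap.det_toLin', ← h2, h1]
    have habs := FramedRep.isAbsolutelyIrreducible_of_isIrreducible_of_det_eq_neg_one VQ hirrVQ
      two_ne_zero hcc hdet
    exact habs (PadicAlgCl p) (algebraMap ℚ_[p] (PadicAlgCl p))

/-- **G3.B2 (per-newform core)** — gen-2's CORE′ with `L_A` at the given `f₀` and an arbitrary finite
exceptional modulus `T₀`: Carayol-Euler at every prime `q ≠ p'` (gen-1 H3/H4), Hecke assembly (H5).
PROVED. -/
theorem isNewformOf_of_cofinalAt_of_carayolEuler (hCE : Carayol1986_eulerFactor)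
    (W : WeierstrassCurve ℚ) [W.IsElliptic] [NeZero (W.conductorNorm ℤ)]
    {N : ℕ} [NeZero N] (f₀ : CuspForm (Gamma0 N) 2) (hf₀ : IsNewform0 f₀) {T₀ : ℕ} (hT₀ : T₀ ≠ 0)
    (hfp : ∀ p : ℕ, p.Prime → ¬ p ∣ T₀ → cuspCoeff f₀ p = (W.LFunction p : ℂ))
    (hRf : RatGaloisRepCofinalAt f₀) : IsNewformOf W f₀ := by
  classical
  have hWpos : 0 < W.conductorNorm ℤ := Nat.pos_of_ne_zero (NeZero.ne _)
  have hB : T₀ * (N * W.conductorNorm ℤ) ≠ 0 :=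
    mul_ne_zero hT₀ (mul_ne_zero (NeZero.ne N) hWpos.ne')
  obtain ⟨p', hp'F, hp'gt, hρ⟩ := hRf (T₀ * (N * W.conductorNorm ℤ))
  have hp' : p'.Prime := hp'F.out
  have hp'B : ¬ p' ∣ T₀ * (N * W.conductorNorm ℤ) := fun hd ↦ by
    have := Nat.le_of_dvd (Nat.pos_of_ne_zero hB) hd; omega
  have hp'T : ¬ p' ∣ T₀ := fun hd ↦ hp'B (dvd_mul_of_dvd_left hd _)
  have hp'N : ¬ p' ∣ N := fun hd ↦ hp'B (dvd_mul_of_dvd_right (dvd_mul_of_dvd_left hd _) _)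
  have hp'W : ¬ p' ∣ W.conductorNorm ℤ := fun hd ↦
    hp'B (dvd_mul_of_dvd_right (dvd_mul_of_dvd_right hd _) _)
  obtain ⟨ι⟩ := PadicAlgCl.nonempty_ringEquiv_complex p'
  obtain ⟨VQ, eV, heV, hV⟩ := exists_framedGaloisRep_rationalTate W p'
  obtain ⟨ρg, hρg, hirr⟩ := hρ ι
  have he := H2'_equiv_of_isGaloisRepOfNewform1 W f₀ hf₀ hT₀ hfp p' ι VQ hV ρg hρg hirr
  have key : ∀ q : ℕ, q.Prime →
      cuspCoeff f₀ q = (W.LFunction q : ℂ) ∧ (q ∣ N ↔ q ∣ W.conductorNorm ℤ) := by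
    intro q hq
    by_cases hqp : q = p'
    · subst hqp
      exact ⟨hfp q hq hp'T, iff_of_false hp'N hp'W⟩
    · set v : HeightOneSpectrum (𝓞 ℚ) := primesEquiv.symm ⟨q, hq⟩ with hvdef
      have hvq : (primesEquiv v : ℕ) = q := by rw [hvdef, Equiv.apply_symm_apply]
      have hv : (p' : 𝓞 ℚ) ∉ v.asIdeal :=
        natCast_not_mem_asIdeal_of_primesEquiv_ne hp' (hvq ▸ hqp)
      have H := H4_cuspCoeff_eq_and_dvd_iff W f₀ hf₀ v
        (H3_map_localPolynomialAt_eq hCE W f₀ hf₀ p' ι ρg hρg hirr VQ eV heV he v hv)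
      rwa [hvq] at H
  exact H5_isNewformOf_of_forall_prime_cuspCoeff_eq_of_dvd_iff W hf₀
    (fun q hq ↦ (key q hq).2) fun q hq ↦ (key q hq).1

end PortK1

/-- **M3 — PROVED (gen 5) by ideator-1's B1 ∘ B2 (`section PortK1`).**  A rational newform `f₀` carrying
`a_p(E)` at EVERY `p ∤ N`, with `E` good off `N`, IS the newform of `E`: realisations of `f₀` at
cofinally many `p` are the `V_p(E)` themselves (`ratGaloisRepCofinalAt_of_curve`), Carayol's Euler
factor (`hCE`) at every `q ∣ N` read on inertia coinvariants of `V_p(E)` gives `a_q(f₀) = a_q(E)` and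
`q ∣ N ↔ q ∣ N_E`, then the Hecke recursions (`isNewformOf_of_cofinalAt_of_carayolEuler`, `T₀ := N`). -/
theorem isNewformOf_of_packet_off_level_of_carayolEuler (hCE : Carayol1986_eulerFactor)
    (W : WeierstrassCurve ℚ) [W.IsElliptic] [NeZero (W.conductorNorm ℤ)] {N : ℕ} [NeZero N]
    (f₀ : CuspForm (Gamma0 N) 2) (hf₀ : IsNewform0 f₀)
    (hgood : ∀ v : HeightOneSpectrum (𝓞 ℚ), ¬ ((primesEquiv v : ℕ) ∣ N) → W.HasGoodReductionAt v)
    (hap : ∀ p : ℕ, p.Prime → ¬ p ∣ N → cuspCoeff f₀ p = (W.LFunction p : ℂ)) :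
    IsNewformOf W f₀ :=
  isNewformOf_of_cofinalAt_of_carayolEuler hCE W f₀ hf₀ (NeZero.ne N) hap
    (ratGaloisRepCofinalAt_of_curve W f₀ hf₀ hgood hap)

/-! ## Glue (kernel-checked) -/

/-- **The two-prime merge (M0 + M1): no hole.**  If `ρ_{E,ℓ₁}` and `ρ_{E,ℓ₂}` are modular for two
distinct primes, ONE newform `f₀ ∈ S₂(Γ₀(N))` carries `a_p(E)` for EVERY `p ∤ N`, and `E` is
good off `N`: the hole of each packet at its own prime is covered by the other packet. -/
theorem exists_isNewform0_packet_off_level_of_two_primes (W : WeierstrassCurve ℚ) [W.IsElliptic]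
    (ℓ₁ ℓ₂ : ℕ) [Fact ℓ₁.Prime] [Fact ℓ₂.Prime] (hne : ℓ₁ ≠ ℓ₂)
    (h₁ : W.IsModularGaloisRepTate ℓ₁) (h₂ : W.IsModularGaloisRepTate ℓ₂) :
    ∃ (N : ℕ) (_ : NeZero N) (f₀ : CuspForm (Gamma0 N) 2), IsNewform0 f₀ ∧
      (∀ v : HeightOneSpectrum (𝓞 ℚ), ¬ ((primesEquiv v : ℕ) ∣ N) → W.HasGoodReductionAt v) ∧
      ∀ p : ℕ, p.Prime → ¬ p ∣ N → cuspCoeff f₀ p = (W.LFunction p : ℂ) := by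
  have hℓ₁ : ℓ₁.Prime := Fact.out
  have hℓ₂ : ℓ₂.Prime := Fact.out
  obtain ⟨N₁, hN₁, f₁, hf₁, hgood₁, hap₁⟩ :=
    exists_isNewform0_hasGoodReductionAt_of_isModularGaloisRepTate W ℓ₁ h₁
  obtain ⟨N₂, hN₂, f₂, hf₂, hgood₂, hap₂⟩ :=
    exists_isNewform0_hasGoodReductionAt_of_isModularGaloisRepTate W ℓ₂ h₂
  have hM : N₁ * ℓ₁ * (N₂ * ℓ₂) ≠ 0 :=
    mul_ne_zero (mul_ne_zero (NeZero.ne N₁) hℓ₁.ne_zero) (mul_ne_zero (NeZero.ne N₂) hℓ₂.ne_zero)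
  have hagree : ∀ p : ℕ, p.Prime → ¬ p ∣ N₁ * ℓ₁ * (N₂ * ℓ₂) →
      cuspCoeff f₁ p = cuspCoeff f₂ p := by
    intro p hp hpM
    rw [hap₁ p hp fun h ↦ hpM (dvd_mul_of_dvd_left h _),
      hap₂ p hp fun h ↦ hpM (dvd_mul_of_dvd_right h _)]
  obtain ⟨hN, hcoeff⟩ := level_eq_and_cuspCoeff_eq_of_cuspCoeff_eq_off hf₁ hf₂ hM hagree
  subst hN
  refine ⟨N₁, hN₁, f₁, hf₁, fun v hv ↦ ?_, fun p hp hpN ↦ ?_⟩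
  · by_cases hv₁ : (primesEquiv v : ℕ) ∣ N₁ * ℓ₁
    · refine hgood₂ v fun hv₂ ↦ ?_
      have hq : (primesEquiv v : ℕ).Prime := (primesEquiv v).2
      have h1 : (primesEquiv v : ℕ) = ℓ₁ :=
        (Nat.prime_dvd_prime_iff_eq hq hℓ₁).mp ((hq.dvd_mul.mp hv₁).resolve_left hv)
      have h2 : (primesEquiv v : ℕ) = ℓ₂ :=
        (Nat.prime_dvd_prime_iff_eq hq hℓ₂).mp ((hq.dvd_mul.mp hv₂).resolve_left hv)
      exact hne (h1.symm.trans h2)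
    · exact hgood₁ v hv₁
  · by_cases hp₁ : p ∣ N₁ * ℓ₁
    · have h1 : p = ℓ₁ :=
        (Nat.prime_dvd_prime_iff_eq hp hℓ₁).mp ((hp.dvd_mul.mp hp₁).resolve_left hpN)
      have hp₂ : ¬ p ∣ N₁ * ℓ₂ := fun h' ↦ hne (h1.symm.trans
        ((Nat.prime_dvd_prime_iff_eq hp hℓ₂).mp ((hp.dvd_mul.mp h').resolve_left hpN)))
      rw [hcoeff p]
      exact hap₂ p hp hp₂
    · exact hap₁ p hp hp₁

/-- **(3)+(3′) ⇒ (2) for EVERY curve from TWO primes, Carayol only** (no Eichler–Shimura leaf). -/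
theorem isModular_of_isModularGaloisRepTate_two_primes (hCE : Carayol1986_eulerFactor)
    (hC : ∀ (N : ℕ) [NeZero N], IsNewformOf.level_eq_conductorNorm (N := N))
    (W : WeierstrassCurve ℚ) [W.IsElliptic] [NeZero (W.conductorNorm ℤ)]
    (ℓ₁ ℓ₂ : ℕ) [Fact ℓ₁.Prime] [Fact ℓ₂.Prime] (hne : ℓ₁ ≠ ℓ₂)
    (h₁ : W.IsModularGaloisRepTate ℓ₁) (h₂ : W.IsModularGaloisRepTate ℓ₂) : BCDT.IsModular W := by
  obtain ⟨N, hN, f₀, hf₀, hgood, hap⟩ :=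
    exists_isNewform0_packet_off_level_of_two_primes W ℓ₁ ℓ₂ hne h₁ h₂
  have hWf : IsNewformOf W f₀ :=
    isNewformOf_of_packet_off_level_of_carayolEuler hCE W f₀ hf₀ hgood hap
  have hNE : N = W.conductorNorm ℤ := hC N hWf
  subst hNE
  exact ⟨f₀, hWf⟩

/-- **`h32CS ⇐ {Carayol1986_eulerFactor, level = conductor}`** (primes `3`, `5`). -/
theorem sigThreeImpTwoCS_of_carayolEuler_of_level (hCE : Carayol1986_eulerFactor)
    (hC : ∀ (N : ℕ) [NeZero N], IsNewformOf.level_eq_conductorNorm (N := N)) :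
    SigThreeImpTwoCS := by
  intro W _ _ h
  haveI : Fact (Nat.Prime 3) := ⟨Nat.prime_three⟩
  exact isModular_of_isModularGaloisRepTate_two_primes hCE hC W 3 5 (by decide) (h 3) (h 5)

/-- **`h32FCS ⇐ {Carayol1986_eulerFactor, FreyLevelEqConductor}`**. -/
theorem sigThreeImpTwoFreyCS_of_carayolEuler_of_freyLevel (hCE : Carayol1986_eulerFactor)
    (hLF : FreyLevelEqConductor) : SigThreeImpTwoFreyCS := by
  intro a b hab h0 _ _ h
  haveI : Fact (Nat.Prime 3) := ⟨Nat.prime_three⟩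
  obtain ⟨N, hN, f₀, hf₀, hgood, hap⟩ :=
    exists_isNewform0_packet_off_level_of_two_primes (freyCurve a b) 3 5 (by decide) (h 3) (h 5)
  have hWf : IsNewformOf (freyCurve a b) f₀ :=
    isNewformOf_of_packet_off_level_of_carayolEuler hCE (freyCurve a b) f₀ hf₀ hgood hap
  have hNE : N = (freyCurve a b).conductorNorm ℤ := hLF a b hab h0 hWf
  subst hNE
  exact ⟨f₀, hWf⟩

/-- **I2 at torsion level, NO named fact**: Tate-modular at every prime ⇒ every framed model of every
`E[ℓ]` is modular (M2 at the torsion prime itself). -/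
theorem isModular_torsion_of_isModularGaloisRepTateAll (W : WeierstrassCurve ℚ) [W.IsElliptic]
    (h : IsModularGaloisRepTateAll W) {ℓ : ℕ} [Fact ℓ.Prime] {ρ : ModPGaloisRep ℚ (ZMod ℓ) 2}
    (hρ : W.IsTorsionGaloisRep ℓ ρ) : ρ.IsModular :=
  isModular_torsion_of_isModularGaloisRepTate_self W ℓ (h ℓ) hρ

/-! ## The recut composition (kernel-checked): S9 never applied to the switched curve -/

/-- **Every Frey curve is modular from the CS-RECUT stub set** `{S1a, S1b-CS, S2-CS, h32FCS, S3}`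
(plus the skeleton's Frey inputs `h4a`, `h4b`, `h6`, `h9`, `h25`): CDT 1999, proof of Thm. 7.1.2
(p. 556), with the modularity of `ρ̄_{E,5} = ρ̄_{W',5}` read off `W'` Tate-modular AT `5` (M2) —
no `BCDT.IsModular W'`, hence no Carayol / Eichler–Shimura for the arbitrary-conductor curve `W'`. -/
theorem isModular_freyCurve_of_recutCS
    (hmod3 : ∀ (W : WeierstrassCurve ℚ) [W.IsElliptic] (ρ : ModPGaloisRep ℚ (ZMod 3) 2),
      W.IsTorsionGaloisRep 3 ρ → FramedRep.IsAbsolutelyIrreducible ρ → ρ.IsModular)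
    (hlift3 : SigLiftThreeCS) (hlift5 : SigLiftFiveCS) (h32 : SigThreeImpTwoFreyCS)
    (h3 : ∀ (W : WeierstrassCurve ℚ) [W.IsElliptic], ¬ 27 ∣ W.conductorNorm ℤ →
      (∀ ρ₃ : ModPGaloisRep ℚ (ZMod 3) 2, W.IsTorsionGaloisRep 3 ρ₃ →
        ¬ ρ₃.IsAbsIrreducibleOverSqrt (-3)) →
      ∀ (ρ : ModPGaloisRep ℚ (ZMod 5) 2), W.IsTorsionGaloisRep 5 ρ → ρ.IsAbsIrreducibleOverSqrt 5 →
      ∃ (W' : WeierstrassCurve ℚ) (_ : W'.IsElliptic), W'.IsTorsionGaloisRep 5 ρ ∧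
        ∃ ρ₃' : ModPGaloisRep ℚ (ZMod 3) 2, W'.IsTorsionGaloisRep 3 ρ₃' ∧
          ρ₃'.IsAbsIrreducibleOverSqrt (-3))
    (h4a : ∀ a b : ℤ, IsCoprime a b → a * b * (a + b) ≠ 0 →
      ∀ ρ : ModPGaloisRep ℚ (ZMod 5) 2, (freyCurve a b).IsTorsionGaloisRep 5 ρ →
        FramedRep.IsIrreducible ρ)
    (h4b : ∀ (W : WeierstrassCurve ℚ) [W.IsElliptic], ¬ 25 ∣ W.conductorNorm ℤ →
      ∀ ρ : ModPGaloisRep ℚ (ZMod 5) 2, W.IsTorsionGaloisRep 5 ρ →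
        FramedRep.IsIrreducible ρ → ρ.IsAbsIrreducibleOverSqrt 5)
    (h6 : ∀ (W W' : WeierstrassCurve ℚ) [W.IsElliptic] [W'.IsElliptic]
      (ρ : ModPGaloisRep ℚ (ZMod 5) 2),
      W.IsTorsionGaloisRep 5 ρ → W'.IsTorsionGaloisRep 5 ρ →
      ¬ 9 ∣ W.conductorNorm ℤ → ¬ 9 ∣ W'.conductorNorm ℤ)
    {a b : ℤ} (hab : IsCoprime a b) (h0 : a * b * (a + b) ≠ 0)
    [NeZero ((freyCurve a b).conductorNorm ℤ)]
    (h9 : ¬ 9 ∣ (freyCurve a b).conductorNorm ℤ) (h25 : ¬ 25 ∣ (freyCurve a b).conductorNorm ℤ) :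
    BCDT.IsModular (freyCurve a b) := by
  haveI := isElliptic_freyCurve h0
  -- case A: `ρ̄_{E,3}|ℚ(√-3)` absolutely irreducible for some framed model — S1a + S1b-CS + h32FCS
  by_cases hA : ∃ ρ₃ : ModPGaloisRep ℚ (ZMod 3) 2,
      (freyCurve a b).IsTorsionGaloisRep 3 ρ₃ ∧ ρ₃.IsAbsIrreducibleOverSqrt (-3)
  · obtain ⟨ρ₃, hρ₃, h3i⟩ := hA
    exact h32 a b hab h0
      (hlift3 (freyCurve a b) ρ₃ hρ₃ h3i h9
        (hmod3 (freyCurve a b) ρ₃ hρ₃ h3i.isAbsolutelyIrreducible))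
  -- case B
  have hB : ∀ ρ₃ : ModPGaloisRep ℚ (ZMod 3) 2, (freyCurve a b).IsTorsionGaloisRep 3 ρ₃ →
      ¬ ρ₃.IsAbsIrreducibleOverSqrt (-3) := fun ρ₃ hρ₃ h3i ↦ hA ⟨ρ₃, hρ₃, h3i⟩
  have h27 : ¬ 27 ∣ (freyCurve a b).conductorNorm ℤ := fun h27 ↦ h9 (dvd_trans ⟨3, rfl⟩ h27)
  obtain ⟨ρ, hρ⟩ := (freyCurve a b).exists_isTorsionGaloisRep 5
  have hirr : FramedRep.IsIrreducible ρ := h4a a b hab h0 ρ hρ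
  have h5 : ρ.IsAbsIrreducibleOverSqrt 5 := h4b (freyCurve a b) h25 ρ hρ hirr
  -- the `3`–`5` switch
  obtain ⟨W', hW', hρ', ρ₃', hρ₃', h3i'⟩ := h3 (freyCurve a b) h27 hB ρ hρ h5
  haveI := hW'
  have h9' : ¬ 9 ∣ W'.conductorNorm ℤ := h6 (freyCurve a b) W' ρ hρ hρ' h9
  -- `W'` is Tate-modular at EVERY prime (S1a + S1b-CS) …
  have hall' : IsModularGaloisRepTateAll W' :=
    hlift3 W' ρ₃' hρ₃' h3i' h9' (hmod3 W' ρ₃' hρ₃' h3i'.isAbsolutelyIrreducible)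
  -- … in particular at `5`, so `ρ̄ = ρ̄_{E,5} = ρ̄_{W',5}` is modular (M2; no (3) ⇒ (2) for `W'`)
  have hρmod : ρ.IsModular := isModular_torsion_of_isModularGaloisRepTateAll W' hall' hρ'
  -- and `E` is modular by S2-CS + h32FCS
  exact h32 a b hab h0 (hlift5 (freyCurve a b) ρ hρ h5 h25 hρmod)

/-- **The crux BY NAME from the CS-recut stubs** (via the landed iff
`freyModularity_iff_forall_isModular_freyCurve`; `h9`, `h25` from the landed
`not_nine_dvd_conductorNorm_freyCurve` and the skeleton's `not_twentyFive_dvd_conductorNorm_freyCurve`). -/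
theorem freyModularity_of_recutCS
    (hmod3 : ∀ (W : WeierstrassCurve ℚ) [W.IsElliptic] (ρ : ModPGaloisRep ℚ (ZMod 3) 2),
      W.IsTorsionGaloisRep 3 ρ → FramedRep.IsAbsolutelyIrreducible ρ → ρ.IsModular)
    (hlift3 : SigLiftThreeCS) (hlift5 : SigLiftFiveCS) (h32 : SigThreeImpTwoFreyCS)
    (h3 : CDT_three_five_switch)
    (h4a : ∀ a b : ℤ, IsCoprime a b → a * b * (a + b) ≠ 0 →
      ∀ ρ : ModPGaloisRep ℚ (ZMod 5) 2, (freyCurve a b).IsTorsionGaloisRep 5 ρ →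
        FramedRep.IsIrreducible ρ)
    (h4b : ∀ (W : WeierstrassCurve ℚ) [W.IsElliptic], ¬ 25 ∣ W.conductorNorm ℤ →
      ∀ ρ : ModPGaloisRep ℚ (ZMod 5) 2, W.IsTorsionGaloisRep 5 ρ →
        FramedRep.IsIrreducible ρ → ρ.IsAbsIrreducibleOverSqrt 5)
    (h6 : ∀ (W W' : WeierstrassCurve ℚ) [W.IsElliptic] [W'.IsElliptic]
      (ρ : ModPGaloisRep ℚ (ZMod 5) 2),
      W.IsTorsionGaloisRep 5 ρ → W'.IsTorsionGaloisRep 5 ρ →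
      ¬ 9 ∣ W.conductorNorm ℤ → ¬ 9 ∣ W'.conductorNorm ℤ)
    (h25 : ∀ a b : ℤ, IsCoprime a b → a * b * (a + b) ≠ 0 →
      ¬ 25 ∣ (freyCurve a b).conductorNorm ℤ) :
    Summit.ABC.ABC.Theses.DefiniteXi.FreyModularity :=
  Summit.ABC.ABC.Theorems.freyModularity_iff_forall_isModular_freyCurve.mpr
    fun _ _ hab h0 _ ↦ isModular_freyCurve_of_recutCS hmod3 hlift3 hlift5 h32 h3 h4a h4b h6 hab h0
      (Summit.ABC.ABC.Theorems.not_nine_dvd_conductorNorm_freyCurve hab h0) (h25 _ _ hab h0)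

/-- **Closing set of the CS-recut line** — four catalogued named facts + Carayol's Euler factor +
level = conductor on the Frey family; NO Eichler–Shimura construction, NO `L_A`, NO Igusa.  The Frey
binders are the skeleton's own LANDED inputs: `h4a := Summit.ABC.ABC.Theorems.isIrreducible_freyCurve_five`
(reshape 3), `h4b := Summit.ABC.ABC.Theorems.stub_absIrrSqrtFive` (p102499),
`h6 := Summit.ABC.ABC.Theorems.stub_nineTransfer` (p110220),
`h25 := Summit.ABC.ABC.Theorems.not_twentyFive_dvd_conductorNorm_freyCurve` — kept as binders here
only because their module chain (`…StubAbsIrrSqrtFiveGroup`) is unbuilt on the current farm snapshot. -/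
theorem freyModularity_of_recutCS_atoms
    (hLT : ∀ σ : FramedArtinRep ℚ 2, Literature.NumberTheory.Automorphic.langlands_tunnell σ)
    (h721 : CDT_theorem_7_2_1) (h722 : CDT_theorem_7_2_2) (hsw : CDT_three_five_switch)
    (hCE : Carayol1986_eulerFactor) (hLF : FreyLevelEqConductor)
    (h4a : ∀ a b : ℤ, IsCoprime a b → a * b * (a + b) ≠ 0 →
      ∀ ρ : ModPGaloisRep ℚ (ZMod 5) 2, (freyCurve a b).IsTorsionGaloisRep 5 ρ →
        FramedRep.IsIrreducible ρ)
    (h4b : ∀ (W : WeierstrassCurve ℚ) [W.IsElliptic], ¬ 25 ∣ W.conductorNorm ℤ →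
      ∀ ρ : ModPGaloisRep ℚ (ZMod 5) 2, W.IsTorsionGaloisRep 5 ρ →
        FramedRep.IsIrreducible ρ → ρ.IsAbsIrreducibleOverSqrt 5)
    (h6 : ∀ (W W' : WeierstrassCurve ℚ) [W.IsElliptic] [W'.IsElliptic]
      (ρ : ModPGaloisRep ℚ (ZMod 5) 2),
      W.IsTorsionGaloisRep 5 ρ → W'.IsTorsionGaloisRep 5 ρ →
      ¬ 9 ∣ W.conductorNorm ℤ → ¬ 9 ∣ W'.conductorNorm ℤ)
    (h25 : ∀ a b : ℤ, IsCoprime a b → a * b * (a + b) ≠ 0 →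
      ¬ 25 ∣ (freyCurve a b).conductorNorm ℤ) :
    Summit.ABC.ABC.Theses.DefiniteXi.FreyModularity :=
  freyModularity_of_recutCS (modThree_of_langlands_tunnell hLT)
    (sigLiftThreeCS_of_CDT_theorem_7_2_1 h721) (sigLiftFiveCS_of_CDT_theorem_7_2_2 h722)
    (sigThreeImpTwoFreyCS_of_carayolEuler_of_freyLevel hCE hLF) hsw h4a h4b h6 h25

end Summit.ABC.ABC.Cruxes.FreyModularity.Sketch.StubIdeasThreeImpTwo2G5

end
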